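import Summits.ValiantsHypothesis.ValiantsHypothesis.Theorems.LacunarySymmetroidMatrixDescartesCensusWindowN
import Summits.ValiantsHypothesis.ValiantsHypothesis.Theorems.LacunarySymmetroidMatrixDescartesCensusLaguerreSum
import Summits.ValiantsHypothesis.ValiantsHypothesis.Theorems.LacunarySymmetroidMatrixDescartesCensusFullAlternation
import Literature.Algebra.Polynomial.DescartesSignVariations

/-!
# `MatrixDescartes` census — sign variations of a fewnomial, and «NO ODD SLACK» (Descartes with parity)

HONEST FRAMING.  Object-search cell `pub-symmetroid`, route crux `Theses.LacunarySymmetroid.MatrixDescartes`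
(ledger item stmt-ValiantsHypothesis-18050).  Elementary theorems about ONE real fewnomial
`f = Σ_{t<n} c_t X^{e_t}` (all `c_t ≠ 0`, `e` strictly increasing), companions of THEOREM N″
(`…CensusWindowNMult.lean`, the window lemma with positive roots counted with multiplicity):

* `signVariations_rsum`: Mathlib's `signVariations f` IS the number of alternating adjacent pairs
  `#{t : c_t c_{t+1} < 0}` (induction with the tree's splitting lemma `signVariations_add_X_pow_mul`);
* `sum_alternating_eq_countP_of_le` («NO ODD SLACK»): if `f` has at least `n − 2` positive roots counted with
  multiplicity then `#{t : c_t c_{t+1} < 0} = #Z₊^{mult}(f) := f.roots.countP (0 < ·)` EXACTLY — Descartes' rule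
  with its parity part (`Literature…Descartes.signVariations_eq_countP_add_two_mul`, BPR Thm 2.33: `Var = Z₊ + 2j`)
  and `Var ≤ n − 1` leave no room for `j ≥ 1`; in particular at most ONE adjacent pair repeats a sign
  (`card_nonalternating_le_one_of_le`).  With THEOREM N″ this gives the window rows from the root count
  `n − 2 ≤ #Z₊^{mult}(f)` ALONE (`newton_window_of_le_countP`, filed with N″) — engine-3 g15's door-A corollary (A)/(B).

Nothing here bears on `ζ_sym`, `DoorA26`/`DoorA34`, the crux, or `VP ≠ VNP`.

[folklore] Descartes' rule of signs with parity (BPR Thm 2.33 in the tree's Literature file).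
-/

-- `Summit.ValiantsHypothesis.ValiantsHypothesis.…` repeats a component by the D-0017 layout
-- (single-conjunct summit), which the `dupNamespace` linter flags; the name is mandated.
set_option linter.dupNamespace false

namespace Summit.ValiantsHypothesis.ValiantsHypothesis.Theorems.LacunarySymmetroidMatrixDescartes.Census

open Polynomial Finset
open scoped BigOperators Polynomial

/-- `Σ_{t<n} c_t X^{e_t}` is non-zero when `n ≥ 1`, `e` is strictly increasing and `c_{n−1} ≠ 0`. [folklore] -/
theorem rsum_ne_zero {n : ℕ} (hn : 1 ≤ n) (e : ℕ → ℕ) (he : StrictMono e) (c : ℕ → ℝ) (hc : c (n - 1) ≠ 0) :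
    (∑ t ∈ range n, C (c t) * X ^ (e t) : ℝ[X]) ≠ 0 := by
  intro h0
  have := coeff_rsum_self e he c (show n - 1 < n by omega)
  rw [h0, coeff_zero] at this
  exact hc this.symm

/-- Leading coefficient of `Σ_{t<n} c_t X^{e_t}` (`n ≥ 1`, `c_{n−1} ≠ 0`). [folklore] -/
theorem leadingCoeff_rsum {n : ℕ} (hn : 1 ≤ n) (e : ℕ → ℕ) (he : StrictMono e) (c : ℕ → ℝ)
    (hc : c (n - 1) ≠ 0) :
    (∑ t ∈ range n, C (c t) * X ^ (e t) : ℝ[X]).leadingCoeff = c (n - 1) := by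
  rw [leadingCoeff, natDegree_rsum hn e he c hc, coeff_rsum_self e he c (by omega)]

/-- **Sign variations of a fewnomial = number of alternating adjacent pairs.**  For `f = Σ_{t<n} c_t X^{e_t}`
with `e` strictly increasing and all `c_t ≠ 0` (`n ≥ 1`), Mathlib's `signVariations f` equals
`#{t < n−1 : c_t c_{t+1} < 0}`. [folklore] -/
theorem signVariations_rsum :
    ∀ (n : ℕ), 1 ≤ n → ∀ (e : ℕ → ℕ), StrictMono e → ∀ (c : ℕ → ℝ), (∀ t, t < n → c t ≠ 0) →
      (∑ t ∈ range n, C (c t) * X ^ (e t) : ℝ[X]).signVariations =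
        ∑ t ∈ range (n - 1), (if c t * c (t + 1) < 0 then 1 else 0) := by
  intro n
  induction n with
  | zero => intro h; omega
  | succ k ih =>
    intro _ e he c hc
    rcases Nat.eq_zero_or_pos k with rfl | hk
    · -- one term: a monomial
      simp only [zero_add, Nat.sub_self, Finset.sum_range_one, Finset.sum_range_zero, C_mul_X_pow_eq_monomial,
        signVariations_monomial]
    · rw [Finset.sum_range_succ, Nat.add_sub_cancel]
      set A : ℝ[X] := ∑ t ∈ range k, C (c t) * X ^ (e t) with hA
      have hcA : c (k - 1) ≠ 0 := hc (k - 1) (by omega)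
      have hA0 : A ≠ 0 := rsum_ne_zero hk e he c hcA
      have hAdeg : A.natDegree = e (k - 1) := natDegree_rsum hk e he c hcA
      have hAlead : A.leadingCoeff = c (k - 1) := leadingCoeff_rsum hk e he c hcA
      have hek : A.natDegree < e k := by rw [hAdeg]; exact he (by omega)
      have hck : c k ≠ 0 := hc k (by omega)
      have hB0 : (C (c k) : ℝ[X]) ≠ 0 := by rwa [Ne, C_eq_zero]
      have hsplit := signVariations_add_X_pow_mul 1 A (C (c k)) (e k) 0 (by
          rw [support_C hck, Finset.card_singleton]) hA0 hek hB0 (fun m hm => by omega)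
        (by rwa [coeff_C_zero])
      rw [mul_comm (C (c k)) (X ^ e k), hsplit, ih hk e he c (fun t ht => hc t (by omega)), hAlead, coeff_C_zero,
        ← monomial_zero_left, signVariations_monomial, add_zero]
      -- the junction indicator is `[c_{k-1} c_k < 0]`
      obtain ⟨k', rfl⟩ : ∃ k', k = k' + 1 := ⟨k - 1, by omega⟩
      rw [Nat.add_sub_cancel, Finset.sum_range_succ]
      congr 1
      have hck' : c k' ≠ 0 := by have := hcA; rwa [Nat.add_sub_cancel] at this
      by_cases hneg : c k' * c (k' + 1) < 0
      · rw [if_pos hneg, if_pos]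
        rcases lt_or_gt_of_ne hck' with h1 | h1
        · have h2 : 0 < c (k' + 1) := by
            by_contra h; rw [not_lt] at h
            have := mul_nonneg_of_nonpos_of_nonpos h1.le h; linarith
          rw [sign_neg h1, sign_pos h2]
        · have h2 : c (k' + 1) < 0 := by
            by_contra h; rw [not_lt] at h
            have := mul_nonneg h1.le h; linarith
          rw [sign_pos h1, sign_neg h2]; decide
      · rw [if_neg hneg, if_neg]
        intro hs
        have := mul_neg_of_sign_eq_neg_sign hck' hs
        rw [mul_comm] at this
        exact hneg this

/-- **NO ODD SLACK (Descartes with parity).**  If `f = Σ_{t<n} c_t X^{e_t}` (`n ≥ 1`, all `c_t ≠ 0`, `e` strictly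
increasing) has at least `n − 2` positive roots counted with multiplicity, then the number of alternating adjacent
pairs EQUALS `#Z₊^{mult}(f)`: by Descartes' rule with its parity part `Var(f) = Z₊ + 2j`
(`Literature…Descartes.signVariations_eq_countP_add_two_mul`, BPR Thm 2.33) and `Var(f) ≤ n − 1`, `j = 0`.
[folklore] -/
theorem sum_alternating_eq_countP_of_le {n : ℕ} (hn : 1 ≤ n) (e : ℕ → ℕ) (he : StrictMono e) (c : ℕ → ℝ)
    (hc : ∀ t, t < n → c t ≠ 0)
    (hZ : n - 2 ≤ (∑ t ∈ range n, C (c t) * X ^ (e t) : ℝ[X]).roots.countP (fun x => 0 < x)) :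
    (∑ t ∈ range (n - 1), (if c t * c (t + 1) < 0 then 1 else 0)) =
      (∑ t ∈ range n, C (c t) * X ^ (e t) : ℝ[X]).roots.countP (fun x => 0 < x) := by
  have hV := signVariations_rsum n hn e he c hc
  obtain ⟨j, hj⟩ := Literature.Algebra.Polynomial.Descartes.signVariations_eq_countP_add_two_mul
    (∑ t ∈ range n, C (c t) * X ^ (e t) : ℝ[X])
  have hle : (∑ t ∈ range (n - 1), (if c t * c (t + 1) < 0 then 1 else 0)) ≤ n - 1 := by
    calc (∑ t ∈ range (n - 1), (if c t * c (t + 1) < 0 then 1 else 0))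
        ≤ ∑ _t ∈ range (n - 1), 1 := Finset.sum_le_sum fun t _ => by split_ifs <;> omega
      _ = n - 1 := by rw [Finset.sum_const, Finset.card_range, smul_eq_mul, mul_one]
  omega

/-- **At most one sign repetition.**  Under the same hypotheses (`n − 2 ≤ #Z₊^{mult}(f)`), at most ONE adjacent
coefficient pair of `f` fails to alternate: `n − 2 ≤ #{t : c_t c_{t+1} < 0}`. [folklore] -/
theorem card_nonalternating_le_one_of_le {n : ℕ} (hn : 1 ≤ n) (e : ℕ → ℕ) (he : StrictMono e) (c : ℕ → ℝ)
    (hc : ∀ t, t < n → c t ≠ 0)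
    (hZ : n - 2 ≤ (∑ t ∈ range n, C (c t) * X ^ (e t) : ℝ[X]).roots.countP (fun x => 0 < x)) :
    n - 2 ≤ ∑ t ∈ range (n - 1), (if c t * c (t + 1) < 0 then 1 else 0) := by
  rw [sum_alternating_eq_countP_of_le hn e he c hc hZ]; exact hZ

end Summit.ValiantsHypothesis.ValiantsHypothesis.Theorems.LacunarySymmetroidMatrixDescartes.Census
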